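import Summits.QuantumAdvantage.QuantumAdvantage.Theorems.WbwObfuscatedGluedTreesKowBbThm9N
import Summits.QuantumAdvantage.QuantumAdvantage.Theorems.WbwObfuscatedGluedTreesKowBbSimN
import Summits.QuantumAdvantage.QuantumAdvantage.Theorems.WbwObfuscatedGluedTreesKowBbCoupling
import Summits.QuantumAdvantage.QuantumAdvantage.Theorems.WbwObfuscatedGluedTreesKowBbBitToQuery
import Summits.QuantumAdvantage.QuantumAdvantage.Theorems.WbwObfuscatedGluedTreesKowBbFunToEmb
import Summits.QuantumAdvantage.QuantumAdvantage.Theorems.WbwObfuscatedGluedTreesKowBbFibre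
import Summits.QuantumAdvantage.QuantumAdvantage.Theorems.WbwObfuscatedGluedTreesKowBbCollision
import Summits.QuantumAdvantage.QuantumAdvantage.Theorems.WbwObfuscatedGluedTreesKowBbNamingTables

/-!
# Line `knowledge-of-walk-split`, STAGE 5 — BLACK-BOX SOUNDNESS of the landed instance format in the IDEAL model
# (crux `WbwObfuscatedGluedTrees`, stmt-QuantumAdvantage-2340, route WhiteBoxWalk; lead prover-line-stmt-QuantumAdvantage-2340-c4-0)

Stages 1–4 (leads -0, -1, c1, c2, c3; `knowledgeTransfer_holds` p92709, `generatorTransfer_holds` p100064,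
`clearReduction_holds` p137178, `residualAudit_holds` p139402) reduced the crux to `ClearHardness` / `ResidualExists`:
does ANY admissible presentation of the neighbour circuit `N_K` of the generator `obfuscatedGluedTreesGen` hide the
EXIT from classical WHITE-BOX walkers?  Every such statement presupposes that the INSTANCE FORMAT of the landed
generator (`Literature/Computability/Cryptography/ObfuscatedGluedTrees.lean`: SIV names
`name(v) = τ ++ (label v ⊕ F_{k₂}(τ))`, `τ = F_{k₁}(label v)`, of length `N = μ + 2d + 3`; a pseudorandom entrance name;
sorted adjacency lists read ONE BIT AT A TIME through `nbrBit`; success = OUTPUT a string with `name(EXIT)` as a prefix)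
loses nothing against BLACK-BOX walkers — the regime where Childs et al. 2003, Theorem 9 (`ChildsEtAl2003_thm9_holds`:
`2d`-bit uniformly random names, `name(ENTRANCE) = 0^{2d}`, the list oracle, success = QUERY the EXIT's name) is the
only hardness supply (Disproof.lean §4 "the black-box supply").  Stage 5 proves this in the IDEAL model (the two PRF
instances of the naming replaced by uniformly random tables `T`, `Mk`; the keyed cycle by a uniform cycle datum):

* (i)  `sivSuccessProb d μ M x t ≤ 4 · 2^{-d/6} + 2 · C(|V(G'_d)|, 2) / 2^μ` for every deterministic, computationally
  unbounded bit-oracle algorithm `M` with advice `x` and `t ≤ 2^{d/6}` rounds (vocabulary: `KowBbVocabulary` p140529);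
* (ii) Theorem 9 at EVERY name length `N ≥ 2d` with a uniformly random entrance name handed to the algorithm
  (`findProbN d N M x t ≤ 4 · 2^{-d/6}`), by a re-randomisation / simulation reduction to `ChildsEtAl2003_thm9_holds`;
* (iii) the generator's naming `naming P μ k₁ k₂ d` IS `sivNaming (tagTableOf P μ k₁ d) (maskTableOf P μ k₂ d)`: the
  ideal model idealises exactly the two tables `ℓ ↦ F_{k₁}(ℓ)` and `τ ↦ F_{k₂}(τ)` (and `eval_instCircuit` in the
  Literature file says the shipped circuit computes `nbrBit σ_K ν_K`, whose oracle is `bitOracle`).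

Composition `WbwObfuscatedGluedTrees_of` from seven registered stubs (§1); the chain is
`sivSuccessProb ≤ P[S | tags distinct] + P_T[tag collision]` (equal fibres of `(T, Mk) ↦ sivName T Mk` over
tag-distinct namings, `stub_fibre`) `≤ P_fun[S] + P_fun[collision] + P_T[collision]` (conditioning)
`≤ bbProb + 2 · tagSlack` (`stub_collision` twice, `stub_funToEmb`) `≤ findProbN (M') + 2 · tagSlack` (`stub_bitToQuery`)
`≤ 4 · 2^{-d/6} + 2 · tagSlack` ((ii), from `stub_simN` + `stub_coupling` + `ChildsEtAl2003_thm9_holds`).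
-/

set_option linter.dupNamespace false

noncomputable section

namespace Summit.QuantumAdvantage.QuantumAdvantage.Cruxes.WbwObfuscatedGluedTrees.KnowledgeOfWalkSplit.BlackBox

open Literature.Computability.Complexity Literature.Computability.QuantumComplexity
open Literature.Computability.QuantumComplexity.GluedTrees
open Literature.Computability.Cryptography Literature.Computability.Cryptography.ObfuscatedGluedTrees
open Summit.QuantumAdvantage.QuantumAdvantage.Theorems.WbwObfuscatedGluedTrees.KnowledgeOfWalk.BlackBox

/-! ## §1 The seven stubs — all LANDED as their own files (imported above) and used BY NAME in `blackBoxSoundness_holds`;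
## their statements are the aliases `Registered.stub_*` of `KowBbChain`

* `stub_simN` (`KowBbSimN`) — simulation of the `N`-bit game inside Game 1 along an injection `g`.
* `stub_coupling` (p141456 `KowBbCoupling`) — re-randomisation `(ν, g) ↦ g ∘ ν` has equal fibres (cross-multiplied count).
* `stub_bitToQuery` (p141460 `KowBbBitToQuery`) — bit-oracle / output-prefix walker ⇒ list-oracle / query walker.
* `stub_funToEmb` (p141425 `KowBbFunToEmb`) — injective functions are the embeddings (counts agree).
* `stub_fibre` (`KowBbFibre`) — `(T, Mk) ↦ sivName T Mk` has equal fibres over tag-distinct namings.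
* `stub_collision` (p141560 `KowBbCollision`) — birthday / union bound for uniform function tables.
* `stub_namingTables` (p141601 `KowBbNamingTables`) — the generator's naming is `sivNaming` of its two PRF tables.

Support files: `KowBbChain` (counting helpers, slacks, `chain_arith`), `KowBbThm9N` (`thm9N_of`: conjunct (ii)).
-/

/-! ## §2 Conjunct (i): the ideal-model bound -/

/-- **Conjunct (i) from the stubs**: the thirteen counts of the chain and their relations, then `chain_arith`. -/
theorem partI_of
    (h9N : ∀ (d N : ℕ) (β : Type) (M : OracleAlg β) (x : List Bool) (t : ℕ), 2 * d ≤ N →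
      (t : ℝ) ≤ (2 : ℝ) ^ ((d : ℝ) / 6) → findProbN d N M x t ≤ 4 * (2 : ℝ) ^ (-((d : ℝ) / 6)))
    (h₃ : Registered.stub_bitToQuery) (h₄ : Registered.stub_funToEmb) (h₅ : Registered.stub_fibre)
    (h₆ : Registered.stub_collision) :
    ∀ (d μ : ℕ) (M : OracleAlg (List Bool)) (x : List Bool) (t : ℕ), (t : ℝ) ≤ (2 : ℝ) ^ ((d : ℝ) / 6) →
      sivSuccessProb d μ M x t ≤ 4 * (2 : ℝ) ^ (-((d : ℝ) / 6)) + 2 * tagSlack d μ := by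
  intro d μ M x t ht
  classical
  have hN : 2 * d ≤ nameLen μ d := by unfold nameLen labelLen; omega
  have hN1 : 1 ≤ nameLen μ d := by unfold nameLen labelLen; omega
  -- Step 0: the success event through the tables
  have h0 : sivSuccessProb d μ M x t =
      ((Finset.univ.filter fun p : CycleDatum d × Tab d μ => EvF M x t p.1 (sivF p.2)).card : ℝ) /
        (Fintype.card (CycleDatum d) * Fintype.card (Tab d μ)) := by
    have hcard : Fintype.card (SivSpace d μ) = Fintype.card (CycleDatum d) * Fintype.card (Tab d μ) :=
      Fintype.card_prod _ _
    have hfilter : (Finset.univ.filter fun p : SivSpace d μ => BitSuccess M x t p.1 (sivNaming p.2.1 p.2.2)) =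
        Finset.univ.filter fun p : CycleDatum d × Tab d μ => EvF M x t p.1 (sivF p.2) :=
      Finset.filter_congr fun p _ => ⟨fun h => ⟨sivName_injective _ _, h⟩, fun ⟨_, h⟩ => h⟩
    unfold sivSuccessProb
    rw [hfilter, hcard, Nat.cast_mul]
  -- Step 1: split along tag-distinctness, slice over `σ`
  have h1 : (Finset.univ.filter fun p : CycleDatum d × Tab d μ => EvF M x t p.1 (sivF p.2)).card ≤
      (∑ σ : CycleDatum d, (Finset.univ.filter fun q : Tab d μ => TDF (sivF q) ∧ EvF M x t σ (sivF q)).card) +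
        Fintype.card (CycleDatum d) * (Finset.univ.filter fun q : Tab d μ => ¬ TDF (sivF q)).card := by
    rw [← card_filter_prod (fun (σ : CycleDatum d) (q : Tab d μ) => TDF (sivF q) ∧ EvF M x t σ (sivF q)),
      ← card_filter_prod_right (fun q : Tab d μ => ¬ TDF (sivF q)),
      ← Finset.card_filter_add_card_filter_not (fun p : CycleDatum d × Tab d μ => TDF (sivF p.2)),
      Finset.filter_filter, Finset.filter_filter]
    refine Nat.add_le_add (le_of_eq ?_) (card_filter_mono fun p hp => hp.2)
    congr 1
    exact Finset.filter_congr fun p _ => and_comm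
  -- Step 2: equal fibres (stub_fibre), summed over `σ`
  have hfib : (∑ σ : CycleDatum d, (Finset.univ.filter fun q : Tab d μ => TDF (sivF q) ∧ EvF M x t σ (sivF q)).card) *
      (Finset.univ.filter fun f : FunN d μ => TDF f).card =
      (∑ σ : CycleDatum d, (Finset.univ.filter fun f : FunN d μ => TDF f ∧ EvF M x t σ f).card) *
      (Finset.univ.filter fun q : Tab d μ => TDF (sivF q)).card := by
    rw [Finset.sum_mul, Finset.sum_mul]
    exact Finset.sum_congr rfl fun σ _ => h₅ d μ (EvF M x t σ)
  have hGt : (Finset.univ.filter fun q : Tab d μ => TDF (sivF q)).card ≤ Fintype.card (Tab d μ) :=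
    Finset.card_filter_le _ _
  have hg0 : (Finset.univ.filter fun f : FunN d μ => TDF f).card = 0 →
      (∑ σ : CycleDatum d, (Finset.univ.filter fun q : Tab d μ => TDF (sivF q) ∧ EvF M x t σ (sivF q)).card) = 0 := by
    intro hz
    rw [Finset.card_eq_zero, Finset.filter_eq_empty_iff] at hz
    refine Finset.sum_eq_zero fun σ _ => ?_
    rw [Finset.card_eq_zero, Finset.filter_eq_empty_iff]
    exact fun q _ hq => hz (Finset.mem_univ (sivF q)) hq.1
  -- Step 3: the conditioning counts
  have ha : (∑ σ : CycleDatum d, (Finset.univ.filter fun f : FunN d μ => TDF f ∧ EvF M x t σ f).card) ≤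
      Fintype.card (CycleDatum d) * (Finset.univ.filter fun f : FunN d μ => TDF f).card := by
    calc _ ≤ ∑ _σ : CycleDatum d, (Finset.univ.filter fun f : FunN d μ => TDF f).card :=
          Finset.sum_le_sum fun σ _ => card_filter_mono fun f hf => hf.1
      _ = _ := by rw [Finset.sum_const, Finset.card_univ, smul_eq_mul]
  have ha' : (∑ σ : CycleDatum d, (Finset.univ.filter fun f : FunN d μ => TDF f ∧ EvF M x t σ f).card) ≤
      ∑ σ : CycleDatum d, (Finset.univ.filter fun f : FunN d μ => EvF M x t σ f).card :=
    Finset.sum_le_sum fun σ _ => card_filter_mono fun f hf => hf.2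
  have hgF : (Finset.univ.filter fun f : FunN d μ => TDF f).card ≤ Fintype.card (FunN d μ) :=
    Finset.card_filter_le _ _
  -- Step 4: functions → embeddings → queries → Theorem 9
  obtain ⟨M', hM'⟩ := h₃ (nameLen μ d) hN1 M
  obtain ⟨hnum, hden⟩ := h₄ d (nameLen μ d) (fun σ ν => BitSuccess M x t σ ν)
  have hs : (∑ σ : CycleDatum d, (Finset.univ.filter fun f : FunN d μ => EvF M x t σ f).card) ≤
      (Finset.univ.filter fun ω : OutcomeN d (nameLen μ d) => BitSuccess M x t ω.1 ω.2).card := by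
    rw [← hnum, card_filter_prod (fun (σ : CycleDatum d) (f : FunN d μ) => EvF M x t σ f)]
  have hOF : (Finset.univ.filter fun ω : OutcomeN d (nameLen μ d) => BitSuccess M x t ω.1 ω.2).card ≤
      (Finset.univ.filter (FindsExitN (d := d) (N := nameLen μ d) M' x t)).card :=
    card_filter_mono fun ω hω => hM' d x t ω.1 ω.2 hω
  have hFO : (Finset.univ.filter (FindsExitN (d := d) (N := nameLen μ d) M' x t)).card ≤
      Fintype.card (OutcomeN d (nameLen μ d)) := Finset.card_filter_le _ _
  have hcO : Fintype.card (OutcomeN d (nameLen μ d)) ≤ Fintype.card (CycleDatum d) * Fintype.card (FunN d μ) := by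
    rw [← Fintype.card_prod]; exact hden
  have h9 := h9N d (nameLen μ d) (List Bool) M' x t hN ht
  unfold findProbN at h9
  -- Step 5: the two slacks
  have slackF : (((Fintype.card (FunN d μ) - (Finset.univ.filter fun f : FunN d μ => TDF f).card : ℕ) : ℝ)) /
      Fintype.card (FunN d μ) ≤ tagSlack d μ := by
    have e : Fintype.card (FunN d μ) - (Finset.univ.filter fun f : FunN d μ => TDF f).card =
        (Finset.univ.filter fun f : FunN d μ => ¬ TDF f).card := by
      rw [← Finset.card_univ, ← Finset.card_filter_add_card_filter_not (fun f : FunN d μ => TDF f),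
        Nat.add_sub_cancel_left]
    rw [e]
    exact slackFun_le h₆ d μ
  have slackT := slackTab_le h₆ d μ
  -- the arithmetic
  rw [h0]
  exact chain_arith h1 hfib hGt hg0 ha ha' hs hOF hFO hcO h9 hgF slackF slackT Fintype.card_pos
    Fintype.card_pos Fintype.card_pos (by positivity)

/-! ## §3 The target of stage 5 and its composition BY NAME -/

/-- **Stage-5 target: black-box soundness of the instance format in the ideal model.** (i) ideal-model bound for
bit-oracle walkers that must output the EXIT's name; (ii) Theorem 9 at every name length `N ≥ 2d` with a random
entrance name; (iii) the generator's naming is the SIV naming of its two PRF tables. -/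
def BlackBoxSoundness : Prop :=
  (∀ (d μ : ℕ) (M : OracleAlg (List Bool)) (x : List Bool) (t : ℕ), (t : ℝ) ≤ (2 : ℝ) ^ ((d : ℝ) / 6) →
      sivSuccessProb d μ M x t ≤ 4 * (2 : ℝ) ^ (-((d : ℝ) / 6)) + 2 * tagSlack d μ) ∧
  (∀ (d N : ℕ) (β : Type) (M : OracleAlg β) (x : List Bool) (t : ℕ), 2 * d ≤ N → (t : ℝ) ≤ (2 : ℝ) ^ ((d : ℝ) / 6) →
      findProbN d N M x t ≤ 4 * (2 : ℝ) ^ (-((d : ℝ) / 6))) ∧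
  (∀ (P : PuncturablePRFScheme) (μ : ℕ) (k₁ k₂ : List Bool) (d : ℕ),
      naming P μ k₁ k₂ d = sivNaming (tagTableOf P μ k₁ d) (maskTableOf P μ k₂ d))

/-- **Composition: the seven registered stubs give the stage-5 target BY NAME.** -/
theorem WbwObfuscatedGluedTrees_of (h₁ : Registered.stub_simN) (h₂ : Registered.stub_coupling)
    (h₃ : Registered.stub_bitToQuery) (h₄ : Registered.stub_funToEmb) (h₅ : Registered.stub_fibre)
    (h₆ : Registered.stub_collision) (h₇ : Registered.stub_namingTables) : BlackBoxSoundness :=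
  ⟨partI_of (thm9N_of h₁ h₂) h₃ h₄ h₅ h₆, thm9N_of h₁ h₂, h₇⟩

/-- **The stage-5 target holds**: the composition fed with the seven LANDED stubs (§1) by name. -/
theorem blackBoxSoundness_holds : BlackBoxSoundness :=
  WbwObfuscatedGluedTrees_of
    Summit.QuantumAdvantage.QuantumAdvantage.Theorems.WbwObfuscatedGluedTrees.KnowledgeOfWalk.BlackBox.stub_simN
    Summit.QuantumAdvantage.QuantumAdvantage.Theorems.WbwObfuscatedGluedTrees.KnowledgeOfWalk.BlackBox.stub_coupling
    Summit.QuantumAdvantage.QuantumAdvantage.Theorems.WbwObfuscatedGluedTrees.KnowledgeOfWalk.BlackBox.stub_bitToQuery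
    Summit.QuantumAdvantage.QuantumAdvantage.Theorems.WbwObfuscatedGluedTrees.KnowledgeOfWalk.BlackBox.stub_funToEmb
    Summit.QuantumAdvantage.QuantumAdvantage.Theorems.WbwObfuscatedGluedTrees.KnowledgeOfWalk.BlackBox.stub_fibre
    Summit.QuantumAdvantage.QuantumAdvantage.Theorems.WbwObfuscatedGluedTrees.KnowledgeOfWalk.BlackBox.stub_collision
    Summit.QuantumAdvantage.QuantumAdvantage.Theorems.WbwObfuscatedGluedTrees.KnowledgeOfWalk.BlackBox.stub_namingTables


/-! ## §4 Numeric form of conjunct (i): the admissible parameter region -/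

/-- The tag slack is at most `2^{2d+3} / 2^μ` (`|V(G'_d)| = 2^{d+2} − 2`). -/
theorem tagSlack_le (d μ : ℕ) : tagSlack d μ ≤ (2 : ℝ) ^ (2 * d + 3) / 2 ^ μ := by
  unfold tagSlack
  have hV : Fintype.card (Vertex d) ≤ 2 ^ (d + 2) := by rw [card_vertex]; exact Nat.sub_le _ _
  have h : (Fintype.card (Vertex d)).choose 2 ≤ 2 ^ (2 * d + 3) := by
    calc (Fintype.card (Vertex d)).choose 2 ≤ (2 ^ (d + 2)).choose 2 := Nat.choose_le_choose 2 hV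
      _ = 2 ^ (d + 2) * (2 ^ (d + 2) - 1) / 2 := Nat.choose_two_right _
      _ ≤ 2 ^ (d + 2) * 2 ^ (d + 2) / 2 := Nat.div_le_div_right (Nat.mul_le_mul_left _ (Nat.sub_le _ _))
      _ = 2 ^ (2 * d + 3) := by
          rw [← pow_add, show d + 2 + (d + 2) = (2 * d + 3) + 1 by ring, pow_succ, Nat.mul_div_cancel _ two_pos]
  have h' : ((Fintype.card (Vertex d)).choose 2 : ℝ) ≤ (2 : ℝ) ^ (2 * d + 3) := by exact_mod_cast h
  exact div_le_div_of_nonneg_right h' (by positivity)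

/-- **Numeric corollary of (i)** — the admissible parameter region of the instance format: against black-box
walkers with `t ≤ 2^{d/6}` rounds the ideal-model success probability is at most `4 · 2^{-d/6} + 2^{2d+4} / 2^μ`,
negligible exactly when the depth `d` grows and the tag length `μ` exceeds `2d + 4` by a growing margin. -/
theorem blackBox_numeric (d μ : ℕ) (M : OracleAlg (List Bool)) (x : List Bool) (t : ℕ)
    (ht : (t : ℝ) ≤ (2 : ℝ) ^ ((d : ℝ) / 6)) :
    sivSuccessProb d μ M x t ≤ 4 * (2 : ℝ) ^ (-((d : ℝ) / 6)) + (2 : ℝ) ^ (2 * d + 4) / 2 ^ μ := by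
  refine (blackBoxSoundness_holds.1 d μ M x t ht).trans (add_le_add le_rfl ?_)
  calc 2 * tagSlack d μ ≤ 2 * ((2 : ℝ) ^ (2 * d + 3) / 2 ^ μ) := by
        have := tagSlack_le d μ; linarith
    _ = (2 : ℝ) ^ (2 * d + 4) / 2 ^ μ := by rw [pow_succ]; ring

/-- **The audit at the generator's own schedules** (`Λ : Params`: depth `Λ.depth n`, tag length `Λ.prfParam n`,
names of length `Λ.N n`): the ideal-model black-box success probability against the instance format of
`obfuscatedGluedTreesGen Λ` at seed length `n`. -/
theorem blackBox_params (Λ : Params) (n : ℕ) (M : OracleAlg (List Bool)) (x : List Bool)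
    (t : ℕ) (ht : (t : ℝ) ≤ (2 : ℝ) ^ (((Λ.depth n : ℕ) : ℝ) / 6)) :
    sivSuccessProb (Λ.depth n) (Λ.prfParam n) M x t ≤
      4 * (2 : ℝ) ^ (-(((Λ.depth n : ℕ) : ℝ) / 6)) + (2 : ℝ) ^ (2 * Λ.depth n + 4) / 2 ^ Λ.prfParam n :=
  blackBox_numeric _ _ M x t ht

end Summit.QuantumAdvantage.QuantumAdvantage.Cruxes.WbwObfuscatedGluedTrees.KnowledgeOfWalkSplit.BlackBox

end
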